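import Mathlib.Analysis.Calculus.ContDiff.Comp
import Mathlib.Analysis.Calculus.FDeriv.CompCLM
import Mathlib.Analysis.Calculus.FDeriv.Equiv
import Mathlib.Analysis.Calculus.TangentCone.Real
import Mathlib.Analysis.InnerProductSpace.LinearMap
import Mathlib.Analysis.InnerProductSpace.PiL2
import Mathlib.Analysis.Normed.Module.Convex
import Mathlib.Geometry.Manifold.Instances.Real
import Mathlib.Geometry.Manifold.MFDeriv.FDeriv

/-!
# Helpers `helper_isStabilising_of_tangential_eq_smul`, `helper_isStabilising_comp_linearIsometry`,
`helper_mfderiv_eq_of_eqOn_closedBall` of line `stable-seam-host` (registry v2) for crux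
`OrigamiFoldExistence` (item stmt-SmoothPoincare4-7844, route route-SmoothPoincare4-SymplecticOrigami)

Wave 2, brick B5: three INVARIANCES of the line's stability clauses `IsStabilising σ θ`
(Cieliebak–Volkov stability of the seam trace `σ` on the unit sphere `S³ ⊂ ℝ⁴`, written in a
chart: `θ` is `C^∞`; (i) `θ ∧ σ ≠ 0` on every linearly independent tangent triple `v ⊥ u`;
(ii) `ker σ(u)|_{u^⊥} ⊂ ker dθ(u)|_{u^⊥}`), used by the lead to transport stability from the model
stable disc to an arbitrary disc via the unoriented disc theorem:

* `helper_isStabilising_of_tangential_eq_smul` — TANGENTIAL RESCALING: if `σ' = k σ` on tangent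
  vectors of the unit sphere, `k ≠ 0`, a stabilising `θ` for `σ` stabilises `σ'` (the expression
  in (i) is multiplied by `k`; the kernel hypothesis of (ii) for `σ'` is that for `σ`).
* `helper_isStabilising_comp_linearIsometry` — ISOMETRY TRANSPORT along `ρ : ℝ⁴ ≃ₗᵢ ℝ⁴`:
  `σ_ρ(u)(v, w) = σ(ρu)(ρv, ρw)` is stabilised by `θ_ρ(u) = θ(ρu) ∘ ρ`; `ρ` preserves norms,
  inner products and linear independence, and by the chain rule
  `Dθ_ρ(u)(v)(w) = Dθ(ρu)(ρv)(ρw)` (`HasFDerivAt.clm_comp` with constant second factor).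
* `helper_mfderiv_eq_of_eqOn_closedBall` — CLOSED-BALL AGREEMENT: two maps `ℝ⁴ → X` that agree
  on the closed unit ball and are differentiable at the points of the unit sphere have the same
  `mfderiv` there (the closed ball is a set of unique differentiability: `uniqueDiffOn_convex`,
  so `mfderiv = mfderivWithin (closedBall 0 1)`, and `mfderivWithin_congr_of_mem`).

No definitions, no named facts, no `sorry`.  Sources: folklore calculus; the clauses are those
of K. Cieliebak, E. Volkov, *First steps in stable Hamiltonian topology*, JEMS 17 (2015), §1.
-/

noncomputable section

-- the prescribed namespace `Summit.<P>.<Sub>.…` duplicates `SmoothPoincare4` (P = Sub)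
set_option linter.dupNamespace false

open scoped Manifold ContDiff Topology RealInnerProductSpace
open Set Function

namespace Summit.SmoothPoincare4.SmoothPoincare4.Theorems.OrigamiFoldExistence.StableSeamHost

/-! ### B5a — tangential rescaling -/

/-- **Tangential rescaling.**  If two traces `σ, σ'` satisfy `σ' = k σ` (`k ≠ 0`) on tangent
vectors of the unit sphere, then every stabilising form `θ` for `σ` stabilises `σ'`: clause (i)
gets multiplied by `k`, and the kernel hypothesis of clause (ii) for `σ'` is the one for `σ`.
[folklore] -/
theorem helper_isStabilising_of_tangential_eq_smul :
    ∀ (σ σ' : EuclideanSpace ℝ (Fin 4) → EuclideanSpace ℝ (Fin 4) → EuclideanSpace ℝ (Fin 4) → ℝ) (θ : EuclideanSpace ℝ (Fin 4) → EuclideanSpace ℝ (Fin 4) →L[ℝ] ℝ) (k : ℝ), k ≠ 0 → (∀ u : EuclideanSpace ℝ (Fin 4), ‖u‖ = 1 → ∀ v w : EuclideanSpace ℝ (Fin 4), ⟪v, u⟫ = 0 → ⟪w, u⟫ = 0 → σ' u v w = k * σ u v w) → (ContDiff ℝ ∞ θ ∧ (∀ u : EuclideanSpace ℝ (Fin 4),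 ‖u‖ = 1 → ∀ v : Fin 3 → EuclideanSpace ℝ (Fin 4), (∀ i, ⟪v i, u⟫ = 0) → LinearIndependent ℝ v → θ u (v 0) * σ u (v 1) (v 2) - θ u (v 1) * σ u (v 0) (v 2) + θ u (v 2) * σ u (v 0) (v 1) ≠ 0) ∧ (∀ u : EuclideanSpace ℝ (Fin 4), ‖u‖ = 1 → ∀ v : EuclideanSpace ℝ (Fin 4), ⟪v, u⟫ = 0 → (∀ w : EuclideanSpace ℝ (Fin 4), ⟪w, u⟫ = 0 → σ u v w = 0) → ∀ w : EuclideanSpace ℝ (Fin 4), ⟪w, u⟫ = 0 → fderiv ℝ θ u v w - fderiv ℝ θ u w v = 0)) → (ContDiff ℝ ∞ θ ∧ (∀ u : EuclideanSpace ℝ (Fin 4), ‖u‖ = 1 → ∀ v : Fin 3 → EuclideanSpace ℝ (Fin 4), (∀ i, ⟪v i, u⟫ = 0) → LinearIndependent ℝ v → θ u (v 0) * σ' u (v 1) (v 2) - θ u (v 1) * σ' u (v 0) (v 2) + θ u (v 2) * σ' u (v 0) (v 1) ≠ 0) ∧ (∀ u : EuclideanSpace ℝ (Fin 4), ‖u‖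 = 1 → ∀ v : EuclideanSpace ℝ (Fin 4), ⟪v, u⟫ = 0 → (∀ w : EuclideanSpace ℝ (Fin 4), ⟪w, u⟫ = 0 → σ' u v w = 0) → ∀ w : EuclideanSpace ℝ (Fin 4), ⟪w, u⟫ = 0 → fderiv ℝ θ u v w - fderiv ℝ θ u w v = 0)) := by
  intro σ σ' θ k hk hσ' h
  obtain ⟨hθ, hi, hii⟩ := h
  refine ⟨hθ, ?_, ?_⟩
  · intro u hu v hvu hv
    rw [hσ' u hu (v 1) (v 2) (hvu 1) (hvu 2), hσ' u hu (v 0) (v 2) (hvu 0) (hvu 2),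
      hσ' u hu (v 0) (v 1) (hvu 0) (hvu 1)]
    have h0 := hi u hu v hvu hv
    have : θ u (v 0) * (k * σ u (v 1) (v 2)) - θ u (v 1) * (k * σ u (v 0) (v 2)) +
        θ u (v 2) * (k * σ u (v 0) (v 1)) =
        k * (θ u (v 0) * σ u (v 1) (v 2) - θ u (v 1) * σ u (v 0) (v 2) +
          θ u (v 2) * σ u (v 0) (v 1)) := by ring
    rw [this]
    exact mul_ne_zero hk h0
  · intro u hu v hv hker w hw
    refine hii u hu v hv (fun w' hw' => ?_) w hw
    have h1 := hker w' hw'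
    rw [hσ' u hu v w' hv hw'] at h1
    rcases mul_eq_zero.1 h1 with h2 | h2
    · exact absurd h2 hk
    · exact h2

/-! ### B5b — isometry transport -/

/-- The derivative of the transported form `θ_ρ(u) = θ(ρu) ∘ ρ` along a linear isometry `ρ`:
`Dθ_ρ(u)(v)(w) = Dθ(ρu)(ρv)(ρw)` (chain rule, the post-composition `L ↦ L ∘ ρ` being a
continuous linear map). [folklore] -/
theorem fderiv_comp_linearIsometryEquiv_apply
    (θ : EuclideanSpace ℝ (Fin 4) → EuclideanSpace ℝ (Fin 4) →L[ℝ] ℝ) (hθ : ContDiff ℝ ∞ θ)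
    (ρ : EuclideanSpace ℝ (Fin 4) ≃ₗᵢ[ℝ] EuclideanSpace ℝ (Fin 4))
    (u v w : EuclideanSpace ℝ (Fin 4)) :
    fderiv ℝ (fun u => (θ (ρ u)).comp
      (ρ.toContinuousLinearEquiv : EuclideanSpace ℝ (Fin 4) →L[ℝ] EuclideanSpace ℝ (Fin 4))) u v w
      = fderiv ℝ θ (ρ u) (ρ v) (ρ w) := by
  have hθat : HasFDerivAt θ (fderiv ℝ θ (ρ u)) (ρ u) :=
    ((hθ.differentiable (by simp)) (ρ u)).hasFDerivAt
  have h1 : HasFDerivAt (fun y => θ (ρ y))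
      ((fderiv ℝ θ (ρ u)).comp
        (ρ.toContinuousLinearEquiv : EuclideanSpace ℝ (Fin 4) →L[ℝ] EuclideanSpace ℝ (Fin 4))) u :=
    hθat.comp u ρ.hasFDerivAt
  have h2 := h1.clm_comp
    (hasFDerivAt_const
      (ρ.toContinuousLinearEquiv : EuclideanSpace ℝ (Fin 4) →L[ℝ] EuclideanSpace ℝ (Fin 4)) u)
  rw [h2.fderiv]
  simp only [ContinuousLinearMap.comp_apply, ContinuousLinearMap.flip_apply,
    ContinuousLinearMap.compL_apply, ContinuousLinearMap.comp_zero, zero_add]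
  rfl

/-- **Isometry transport.**  Stability data `(σ, θ)` transport along a linear isometry `ρ` of
`ℝ⁴` to `(σ_ρ, θ_ρ)`, `σ_ρ(u)(v, w) = σ(ρu)(ρv, ρw)`, `θ_ρ(u) = θ(ρu) ∘ ρ`: `ρ` preserves the
unit sphere, orthogonality and linear independence, and `Dθ_ρ(u)(v)(w) = Dθ(ρu)(ρv)(ρw)`.
(Used with `ρ` the reflection of the unoriented disc theorem.) [folklore] -/
theorem helper_isStabilising_comp_linearIsometry :
    ∀ (σ : EuclideanSpace ℝ (Fin 4) → EuclideanSpace ℝ (Fin 4) → EuclideanSpace ℝ (Fin 4) → ℝ) (θ : EuclideanSpace ℝ (Fin 4) → EuclideanSpace ℝ (Fin 4) →L[ℝ] ℝ) (ρ : EuclideanSpace ℝ (Fin 4) ≃ₗᵢ[ℝ] EuclideanSpace ℝ (Fin 4)), (ContDiff ℝ ∞ θ ∧ (∀ u : EuclideanSpace ℝ (Fin 4), ‖u‖ = 1 → ∀ v : Fin 3 → EuclideanSpace ℝ (Fin 4), (∀ i, ⟪v i, u⟫ = 0) → LinearIndependent ℝ v → θ u (v 0) * σ u (v 1) (v 2)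 - θ u (v 1) * σ u (v 0) (v 2) + θ u (v 2) * σ u (v 0) (v 1) ≠ 0) ∧ (∀ u : EuclideanSpace ℝ (Fin 4), ‖u‖ = 1 → ∀ v : EuclideanSpace ℝ (Fin 4), ⟪v, u⟫ = 0 → (∀ w : EuclideanSpace ℝ (Fin 4), ⟪w, u⟫ = 0 → σ u v w = 0) → ∀ w : EuclideanSpace ℝ (Fin 4), ⟪w, u⟫ = 0 → fderiv ℝ θ u v w - fderiv ℝ θ u w v = 0)) → (ContDiff ℝ ∞ (fun u => (θ (ρ u)).comp (ρ.toContinuousLinearEquiv : EuclideanSpace ℝ (Fin 4) →L[ℝ] EuclideanSpace ℝ (Fin 4))) ∧ (∀ u : EuclideanSpace ℝ (Fin 4), ‖u‖ = 1 → ∀ v : Fin 3 → EuclideanSpace ℝ (Fin 4), (∀ i, ⟪v i, u⟫ = 0) → LinearIndependent ℝ v → (θ (ρ u)) (ρ (v 0)) * σ (ρ u) (ρ (v 1)) (ρ (v 2)) - (θ (ρ u)) (ρ (v 1)) * σ (ρ u) (ρ (v 0)) (ρ (v 2)) + (θ (ρ u)) (ρ (v 2)) * σ (ρ u) (ρ (v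 0)) (ρ (v 1)) ≠ 0) ∧ (∀ u : EuclideanSpace ℝ (Fin 4), ‖u‖ = 1 → ∀ v : EuclideanSpace ℝ (Fin 4), ⟪v, u⟫ = 0 → (∀ w : EuclideanSpace ℝ (Fin 4), ⟪w, u⟫ = 0 → σ (ρ u) (ρ v) (ρ w) = 0) → ∀ w : EuclideanSpace ℝ (Fin 4), ⟪w, u⟫ = 0 → fderiv ℝ (fun u => (θ (ρ u)).comp (ρ.toContinuousLinearEquiv : EuclideanSpace ℝ (Fin 4) →L[ℝ] EuclideanSpace ℝ (Fin 4))) u v w - fderiv ℝ (fun u => (θ (ρ u)).comp (ρ.toContinuousLinearEquiv : EuclideanSpace ℝ (Fin 4) →L[ℝ] EuclideanSpace ℝ (Fin 4))) u w v = 0)) := by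
  intro σ θ ρ h
  obtain ⟨hθ, hi, hii⟩ := h
  -- `ρ` maps the unit sphere to itself and preserves orthogonality
  have hnorm : ∀ u : EuclideanSpace ℝ (Fin 4), ‖u‖ = 1 → ‖ρ u‖ = 1 := fun u hu => by
    rw [ρ.norm_map, hu]
  have horth : ∀ u v : EuclideanSpace ℝ (Fin 4), ⟪v, u⟫ = 0 → ⟪ρ v, ρ u⟫ = 0 := fun u v hv => by
    rw [ρ.inner_map_map, hv]
  refine ⟨?_, ?_, ?_⟩
  · -- smoothness: composition of smooth maps
    exact (hθ.comp ρ.contDiff).clm_comp contDiff_const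
  · intro u hu v hvu hv
    have hv' : LinearIndependent ℝ (fun i => ρ (v i)) :=
      hv.map' (ρ.toLinearEquiv : EuclideanSpace ℝ (Fin 4) →ₗ[ℝ] EuclideanSpace ℝ (Fin 4))
        ρ.toLinearEquiv.ker
    exact hi (ρ u) (hnorm u hu) (fun i => ρ (v i)) (fun i => horth u (v i) (hvu i)) hv'
  · intro u hu v hv hker w hw
    rw [fderiv_comp_linearIsometryEquiv_apply θ hθ ρ u v w,
      fderiv_comp_linearIsometryEquiv_apply θ hθ ρ u w v]
    refine hii (ρ u) (hnorm u hu) (ρ v) (horth u v hv) (fun w' hw' => ?_) (ρ w) (horth u w hw)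
    have h1 : ⟪ρ.symm w', u⟫ = 0 := by
      rw [← ρ.inner_map_map, ρ.apply_symm_apply]
      exact hw'
    have h2 := hker (ρ.symm w') h1
    rwa [ρ.apply_symm_apply] at h2

/-! ### B5c — closed-ball agreement -/

/-- **Closed-ball agreement.**  Two maps `ℝ⁴ → X` into an `ℝ⁴`-charted manifold which agree on
the closed unit ball and are differentiable at the points of the unit sphere have the same
`mfderiv` at every point of the unit sphere: the closed unit ball is convex with nonempty
interior, hence a set of unique differentiability, so there `mfderiv = mfderivWithin B̄`, and the
latter only depends on the restriction to `B̄`. [folklore] -/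
theorem helper_mfderiv_eq_of_eqOn_closedBall :
    ∀ (X : Type) [TopologicalSpace X] [ChartedSpace (EuclideanSpace ℝ (Fin 4)) X] [IsManifold (𝓡 4) ∞ X] (f g : EuclideanSpace ℝ (Fin 4) → X), (∀ u ∈ Metric.closedBall (0 : EuclideanSpace ℝ (Fin 4)) 1, f u = g u) → (∀ u ∈ Metric.sphere (0 : EuclideanSpace ℝ (Fin 4)) 1, MDifferentiableAt 𝓘(ℝ, EuclideanSpace ℝ (Fin 4)) (𝓡 4) f u) → (∀ u ∈ Metric.sphere (0 : EuclideanSpace ℝ (Fin 4)) 1, MDifferentiableAt 𝓘(ℝ, EuclideanSpace ℝ (Fin 4)) (𝓡 4) g u) → ∀ u ∈ Metric.sphere (0 : EuclideanSpace ℝ (Fin 4)) 1, mfderiv 𝓘(ℝ, EuclideanSpace ℝ (Fin 4)) (𝓡 4) f u = mfderiv 𝓘(ℝ, EuclideanSpace ℝ (Fin 4)) (𝓡 4) g u := by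
  intro X _ _ _ f g hfg hf hg u hu
  have hu' : u ∈ Metric.closedBall (0 : EuclideanSpace ℝ (Fin 4)) 1 :=
    Metric.sphere_subset_closedBall hu
  -- the closed unit ball is a set of unique differentiability
  have hU : UniqueDiffOn ℝ (Metric.closedBall (0 : EuclideanSpace ℝ (Fin 4)) 1) :=
    uniqueDiffOn_convex (convex_closedBall _ _)
      ⟨0, Metric.ball_subset_interior_closedBall (Metric.mem_ball_self zero_lt_one)⟩
  have hUm : UniqueMDiffWithinAt 𝓘(ℝ, EuclideanSpace ℝ (Fin 4))
      (Metric.closedBall (0 : EuclideanSpace ℝ (Fin 4)) 1) u :=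
    (uniqueMDiffWithinAt_iff_uniqueDiffWithinAt).2 (hU u hu')
  rw [← mfderivWithin_eq_mfderiv hUm (hf u hu), ← mfderivWithin_eq_mfderiv hUm (hg u hu)]
  exact mfderivWithin_congr_of_mem hfg hu'

end Summit.SmoothPoincare4.SmoothPoincare4.Theorems.OrigamiFoldExistence.StableSeamHost

end
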